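import Literature.Probability.Percolation.IsoradialCriticalityProofs
import Summits.CriticalPhenomena.CardyFormulaZ2.Theorems.CardyBondTriangularTriIsoradialInstance
import HarnessLib

/-!
# Route CardyBondTriangular · crux `BondTriangularCardy` · line `birth`: a quantitative one-arm bound for isoradial bond percolation from upper box-crossing bounds

Helper of the stub `stub_equicontinuity` (input of the yellow annulus bound, hypothesis (B) of
`equicontinuity_of_arms_of_annulusBounds`). The quantitative content of the tree's
`IsoradialCriticality.measure_percolatesAt_eq_zero_of_upperBounds` (Grimmett–Manolescu, PTRF 159
(2014) Thm. 4 (b) "as in [GM1]"; GM1 = Ann. Probab. 41 (2013) §4.1 Prop. 23: "if `rad(C_v) ≥ k`,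
there exist order `log k` disjoint annuli around `v` none of which [is uncrossed]"), with THIN
annuli so that any prescribed inner radius is allowed: for a preconnected graph isoradially and
rhombically embedded with BAP(ε), if every `(n/10) × n` rectangle is crossed the short way with
probability `≤ 1 - c` for `n ≥ n₀` (the upper half of the box-crossing property at aspect ratio
`1/10`), then an open path from the sup-norm box `Λ_{ρᵢₙ}(x)` to outside `Λ_{ρₒᵤₜ}(x)` has
probability `≤ (1 - c⁴)^(K+1)` as soon as the `K + 1` annuli `Λ_{10 m_k} ∖ Λ_{8 m_k - 4}`,
`m_k = M₀ 2^k` (`k ≤ K`, `20 M₀ ≥ n₀`), fit between the two boxes (`ρᵢₙ ≤ 8 M₀ - 2`,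
`10 M₀ 2^K - 2 ≤ ρₒᵤₜ`): an open path from `Λ_{8m-2}` to `∂Λ_{10m-2}` crosses one of four
`2m × 20m` strips the short way (`exists_strip_crossing`), which by Harris has probability
`≤ 1 - c⁴`, and the annuli carry independent events. No duality is used.

## References

* G. R. Grimmett, I. Manolescu, PTRF 159 (2014) = arXiv:1204.0505v2, §3 Thm. 4 (b) and its proof.
* G. R. Grimmett, I. Manolescu, Ann. Probab. 41 (2013) = arXiv:1105.5535, §4.1 Prop. 23 [GM1].
* G. Grimmett, *Percolation*, 2nd ed. (1999), Thm. (2.4) (Harris), §2.2.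
-/

noncomputable section

namespace Summit.CriticalPhenomena.CardyFormulaZ2.Theorems

open MeasureTheory Set
open Literature.Probability.Percolation Literature.Probability.LatticeModels
open Literature.Probability.Percolation.IsoradialCriticality

variable {V F : Type*} {G : SimpleGraph V} (emb : RhombicEmbedding G F)

/-- **Quantitative one-arm bound from upper box-crossing bounds, thin annuli** (the argument of
Grimmett–Manolescu 2014, proof of Thm. 4 (b), "as in [GM1]" §4.1 Prop. 23, with annuli of
sup-norm radii `8m - 4` and `10m`): for a preconnected graph isoradially and rhombically embedded
with BAP(ε), if the short-way crossings of all `(n/10) × n` and `n × (n/10)` rectangles have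
probability `≤ 1 - c` for `n ≥ n₀`, then for `20 M₀ ≥ n₀`, `M₀ ≥ 1`, `ρᵢₙ ≤ 8 M₀ - 2` and
`10 M₀ 2^K - 2 ≤ ρₒᵤₜ`, the event that some vertex drawn in the box `Λ_{ρᵢₙ}(x)` is joined by an
open path to a vertex drawn outside the open box of radius `ρₒᵤₜ` has probability at most
`(1 - c⁴)^(K+1)`. -/
theorem real_openArm_le_pow [Countable V] {ε : ℝ}
    (hconn : G.Preconnected) (hiso : emb.IsIsoradial) (hrh : emb.IsRhombicTiling) (hε : 0 < ε)
    (hbap : emb.HasBoundedAngles ε) {c : ℝ} (hc : 0 < c) {n₀ : ℕ}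
    (hbd0 : ∀ n : ℕ, n₀ ≤ n → ∀ w : ℂ,
      emb.isoradialPercolation.real
          (embRectCrossing (fun v => emb.z v - w) ((1 / 10 : ℝ) * n) n) ≤ 1 - c ∧
        emb.isoradialPercolation.real
          (embTBCrossing (fun v => emb.z v - w) n ((1 / 10 : ℝ) * n)) ≤ 1 - c)
    (x : ℂ) {M₀ : ℕ} (hM₀ : n₀ ≤ 20 * M₀) (hM₀1 : 1 ≤ M₀) (K : ℕ) {ρin ρout : ℝ}
    (hin : ρin ≤ 8 * M₀ - 2) (hout : 10 * (M₀ : ℝ) * 2 ^ K - 2 ≤ ρout) :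
    emb.isoradialPercolation.real {ω | ∃ u v : V, (openGraph ω).Reachable u v ∧
        (emb.z u - x).boxNorm ≤ ρin ∧ ρout ≤ (emb.z v - x).boxNorm} ≤ (1 - c ^ 4) ^ (K + 1) := by
  classical
  set μ := emb.isoradialPercolation with hμdef
  have hμ : μ = prodBernoulli emb.edgeWeight := rfl
  set Arm : Set (BondConfig V) := {ω | ∃ u v : V, (openGraph ω).Reachable u v ∧
      (emb.z u - x).boxNorm ≤ ρin ∧ ρout ≤ (emb.z v - x).boxNorm} with hArm
  have hq0 : 0 ≤ 1 - c ^ 4 := by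
    have h1 := (hbd0 n₀ le_rfl 0).1
    have h2 : 0 ≤ μ.real (embRectCrossing (fun v => emb.z v - 0) ((1 / 10 : ℝ) * n₀) n₀) :=
      measureReal_nonneg
    have hc1 : c ≤ 1 := by linarith
    have : c ^ 4 ≤ 1 := pow_le_one₀ hc.le hc1
    linarith
  /- Step 0: discard the null set of configurations using non-edges of `G`. -/
  set good : Set (BondConfig V) := {ω | ω ⊆ G.edgeSet} with hgood_def
  have hN0 : μ {ω : BondConfig V | ¬ ω ⊆ G.edgeSet} = 0 :=
    isoradialPercolation_not_subset_edgeSet emb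
  suffices hgood : μ.real (Arm ∩ good) ≤ (1 - c ^ 4) ^ (K + 1) by
    calc μ.real Arm ≤ μ.real (Arm ∩ good ∪ {ω : BondConfig V | ¬ ω ⊆ G.edgeSet}) :=
          measureReal_mono fun ω hω => by
            by_cases h : ω ⊆ G.edgeSet
            · exact Or.inl ⟨hω, h⟩
            · exact Or.inr h
      _ ≤ μ.real (Arm ∩ good) + μ.real {ω : BondConfig V | ¬ ω ⊆ G.edgeSet} :=
          measureReal_union_le _ _
      _ = μ.real (Arm ∩ good) := by
          have h0 : μ.real {ω : BondConfig V | ¬ ω ⊆ G.edgeSet} = 0 := by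
            rw [measureReal_def, hN0, ENNReal.toReal_zero]
          rw [h0, add_zero]
      _ ≤ (1 - c ^ 4) ^ (K + 1) := hgood
  /- Step 1: the degenerate case of a graph without edges. -/
  have hρ : ρin < ρout := by
    have h1 : (1 : ℝ) ≤ 2 ^ K := one_le_pow₀ (by norm_num)
    have hM : (1 : ℝ) ≤ M₀ := by exact_mod_cast hM₀1
    nlinarith
  by_cases hE : ∃ a b : V, G.Adj a b
  swap
  · have hempty : Arm ∩ good = ∅ := by
      ext ω
      simp only [Set.mem_inter_iff, Set.mem_empty_iff_false, iff_false, not_and]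
      rintro ⟨u, v, huv, hu, hv⟩ hω
      apply hE
      obtain ⟨w⟩ := huv
      cases w with
      | nil => exfalso; linarith
      | cons h _ =>
        rw [openGraph_adj] at h
        exact ⟨_, _, hω h.1⟩
    rw [hempty, measureReal_empty]
    exact pow_nonneg hq0 _
  obtain ⟨a₀, b₀, hab₀⟩ := hE
  have hnb : ∀ v : V, ∃ u, G.Adj v u := exists_adj_of_preconnected hconn hab₀
  /- Step 2: the re-centred drawing, local finiteness, short open edges. -/
  set z' : V → ℂ := fun v => emb.z v - x with hz'
  have hfin : ∀ R : ℝ, {v : V | (z' v).boxNorm ≤ R}.Finite := fun R =>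
    finite_setOf_boxNorm_le hiso hrh hbap hε hnb x R
  have hH : ∀ {ω : BondConfig V}, ω ⊆ G.edgeSet → ∀ ⦃a b : V⦄, (openGraph ω).Adj a b →
      |(z' a).re - (z' b).re| < 2 ∧ |(z' a).im - (z' b).im| < 2 := by
    intro ω hω a b hab
    rw [openGraph_adj] at hab
    have := abs_sub_lt_two_of_adj hiso (hω hab.1 : G.Adj a b)
    simpa [hz'] using this
  /- Step 3: the four strip events at scale `m` (shape of the upper bounds with `ρ = 1/10`,
  `n = 20m`), their union, and the thin annulus of vertices carrying them. -/
  set strip : ℕ → Fin 4 → Set (BondConfig V) := fun m =>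
    ![embRectCrossing (fun v => z' v - ⟨8 * (m : ℝ) - 2, -(10 * (m : ℝ))⟩)
        ((1 / 10 : ℝ) * ((20 * m : ℕ) : ℝ)) ((20 * m : ℕ) : ℝ),
      embRectCrossing (fun v => z' v - ⟨-(10 * (m : ℝ) - 2), -(10 * (m : ℝ))⟩)
        ((1 / 10 : ℝ) * ((20 * m : ℕ) : ℝ)) ((20 * m : ℕ) : ℝ),
      embTBCrossing (fun v => z' v - ⟨-(10 * (m : ℝ)), 8 * (m : ℝ) - 2⟩)
        ((20 * m : ℕ) : ℝ) ((1 / 10 : ℝ) * ((20 * m : ℕ) : ℝ)),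
      embTBCrossing (fun v => z' v - ⟨-(10 * (m : ℝ)), -(10 * (m : ℝ) - 2)⟩)
        ((20 * m : ℕ) : ℝ) ((1 / 10 : ℝ) * ((20 * m : ℕ) : ℝ))] with hstrip
  set U : ℕ → Set (BondConfig V) := fun m => ⋃ i, strip m i with hUdef
  set region : ℕ → Set V := fun m =>
    {v | 8 * (m : ℝ) - 4 ≤ (z' v).boxNorm ∧ (z' v).boxNorm ≤ 10 * m} with hregion
  have h20 : ∀ m : ℕ, ((20 * m : ℕ) : ℝ) = 20 * m := fun m => by push_cast; ring
  -- each strip is an open-crossing event inside `region m`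
  have hstripS : ∀ {m : ℕ}, 1 ≤ m → ∀ i : Fin 4,
      ∃ S A B : Set V, strip m i = openCrossing S A B ∧ S ⊆ region m := by
    intro m hm i
    have hm' : (1 : ℝ) ≤ m := by exact_mod_cast hm
    have h20m := h20 m
    fin_cases i
    · refine ⟨_, _, _, rfl, ?_⟩
      rintro v ⟨⟨h1, h2⟩, ⟨h3, h4⟩⟩
      simp only [Complex.sub_re, Complex.sub_im, h20m] at h1 h2 h3 h4
      refine ⟨?_, ?_⟩
      · exact le_trans (by linarith) ((le_abs_self _).trans (abs_re_le_boxNorm (z' v)))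
      · unfold Complex.boxNorm
        exact max_le (abs_le.2 ⟨by linarith, by linarith⟩) (abs_le.2 ⟨by linarith, by linarith⟩)
    · refine ⟨_, _, _, rfl, ?_⟩
      rintro v ⟨⟨h1, h2⟩, ⟨h3, h4⟩⟩
      simp only [Complex.sub_re, Complex.sub_im, h20m] at h1 h2 h3 h4
      refine ⟨?_, ?_⟩
      · exact le_trans (by linarith) ((neg_le_abs _).trans (abs_re_le_boxNorm (z' v)))
      · unfold Complex.boxNorm
        exact max_le (abs_le.2 ⟨by linarith, by linarith⟩) (abs_le.2 ⟨by linarith, by linarith⟩)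
    · refine ⟨_, _, _, rfl, ?_⟩
      rintro v ⟨⟨h1, h2⟩, ⟨h3, h4⟩⟩
      simp only [Complex.sub_re, Complex.sub_im, h20m] at h1 h2 h3 h4
      refine ⟨?_, ?_⟩
      · exact le_trans (by linarith) ((le_abs_self _).trans (abs_im_le_boxNorm (z' v)))
      · unfold Complex.boxNorm
        exact max_le (abs_le.2 ⟨by linarith, by linarith⟩) (abs_le.2 ⟨by linarith, by linarith⟩)
    · refine ⟨_, _, _, rfl, ?_⟩
      rintro v ⟨⟨h1, h2⟩, ⟨h3, h4⟩⟩
      simp only [Complex.sub_re, Complex.sub_im, h20m] at h1 h2 h3 h4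
      refine ⟨?_, ?_⟩
      · exact le_trans (by linarith) ((neg_le_abs _).trans (abs_im_le_boxNorm (z' v)))
      · unfold Complex.boxNorm
        exact max_le (abs_le.2 ⟨by linarith, by linarith⟩) (abs_le.2 ⟨by linarith, by linarith⟩)
  -- the strips are increasing events
  have hupper : ∀ m i, IsUpperSet (strip m i) := by
    intro m i
    fin_cases i
    · exact isUpperSet_embRectCrossing _ _ _
    · exact isUpperSet_embRectCrossing _ _ _
    · exact isUpperSet_embTBCrossing _ _ _
    · exact isUpperSet_embTBCrossing _ _ _
  -- an open path from `Λ_{8m-2}` to sup-norm distance `10m-2` crosses one of the four strips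
  have hmemU : ∀ {ω : BondConfig V}, ω ⊆ G.edgeSet → ∀ {m : ℕ}, 1 ≤ m →
      ∀ {u v : V} (w : (openGraph ω).Walk u v),
        (z' u).boxNorm ≤ 8 * m - 2 → 10 * (m : ℝ) - 2 ≤ (z' v).boxNorm → ω ∈ U m := by
    intro ω hω m hm u v w hu hv
    have hm' : (1 : ℝ) ≤ m := by exact_mod_cast hm
    have h20m := h20 m
    have hrL : 8 * (m : ℝ) - 2 < 10 * m - 2 := by linarith
    obtain ⟨a, b, W, hcase⟩ := exists_strip_crossing z' (hH hω) hrL w hu hv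
    simp only [hUdef, Set.mem_iUnion]
    rcases hcase with ⟨ha, hb, hW⟩ | ⟨ha, hb, hW⟩ | ⟨ha, hb, hW⟩ | ⟨ha, hb, hW⟩
    · -- right strip
      refine ⟨0, a, ?_, b, ?_, mem_openConnIn_iff_exists_openWalk.2 ⟨W, fun t ht => ?_⟩⟩
      · show (z' a - _).re ≤ 0
        simp only [Complex.sub_re]; linarith
      · show (1 / 10 : ℝ) * ((20 * m : ℕ) : ℝ) ≤ (z' b - _).re
        simp only [Complex.sub_re, h20m]; linarith
      · obtain ⟨h1, h2, h3⟩ := hW t ht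
        have h3' := abs_le.1 h3
        show (z' t - _).re ∈ Set.Icc (-2 : ℝ) _ ∧ (z' t - _).im ∈ Set.Icc (0 : ℝ) _
        simp only [Complex.sub_re, Complex.sub_im, h20m, Set.mem_Icc]
        exact ⟨⟨by linarith, by linarith⟩, ⟨by linarith, by linarith⟩⟩
    · -- left strip (walk reversed: from `b` in `{re ≤ -(10m-2)}` to `a` in `{-(8m-2) ≤ re}`)
      refine ⟨1, b, ?_, a, ?_, mem_openConnIn_iff_exists_openWalk.2 ⟨W.reverse, fun t ht => ?_⟩⟩
      · show (z' b - _).re ≤ 0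
        simp only [Complex.sub_re]; linarith
      · show (1 / 10 : ℝ) * ((20 * m : ℕ) : ℝ) ≤ (z' a - _).re
        simp only [Complex.sub_re, h20m]; linarith
      · rw [SimpleGraph.Walk.support_reverse, List.mem_reverse] at ht
        obtain ⟨h1, h2, h3⟩ := hW t ht
        have h3' := abs_le.1 h3
        show (z' t - _).re ∈ Set.Icc (-2 : ℝ) _ ∧ (z' t - _).im ∈ Set.Icc (0 : ℝ) _
        simp only [Complex.sub_re, Complex.sub_im, h20m, Set.mem_Icc]
        exact ⟨⟨by linarith, by linarith⟩, ⟨by linarith, by linarith⟩⟩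
    · -- top strip
      refine ⟨2, a, ?_, b, ?_, mem_openConnIn_iff_exists_openWalk.2 ⟨W, fun t ht => ?_⟩⟩
      · show (z' a - _).im ≤ 0
        simp only [Complex.sub_im]; linarith
      · show (1 / 10 : ℝ) * ((20 * m : ℕ) : ℝ) ≤ (z' b - _).im
        simp only [Complex.sub_im, h20m]; linarith
      · obtain ⟨h1, h2, h3⟩ := hW t ht
        have h3' := abs_le.1 h3
        show (z' t - _).re ∈ Set.Icc (0 : ℝ) _ ∧ (z' t - _).im ∈ Set.Icc (-2 : ℝ) _
        simp only [Complex.sub_re, Complex.sub_im, h20m, Set.mem_Icc]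
        exact ⟨⟨by linarith, by linarith⟩, ⟨by linarith, by linarith⟩⟩
    · -- bottom strip (walk reversed)
      refine ⟨3, b, ?_, a, ?_, mem_openConnIn_iff_exists_openWalk.2 ⟨W.reverse, fun t ht => ?_⟩⟩
      · show (z' b - _).im ≤ 0
        simp only [Complex.sub_im]; linarith
      · show (1 / 10 : ℝ) * ((20 * m : ℕ) : ℝ) ≤ (z' a - _).im
        simp only [Complex.sub_im, h20m]; linarith
      · rw [SimpleGraph.Walk.support_reverse, List.mem_reverse] at ht
        obtain ⟨h1, h2, h3⟩ := hW t ht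
        have h3' := abs_le.1 h3
        show (z' t - _).re ∈ Set.Icc (0 : ℝ) _ ∧ (z' t - _).im ∈ Set.Icc (-2 : ℝ) _
        simp only [Complex.sub_re, Complex.sub_im, h20m, Set.mem_Icc]
        exact ⟨⟨by linarith, by linarith⟩, ⟨by linarith, by linarith⟩⟩
  /- Step 4: the upper crossing bounds at aspect ratio `1/10`, for the re-centred drawing. -/
  have hbd : ∀ n : ℕ, n₀ ≤ n → ∀ w : ℂ,
      μ.real (embRectCrossing (fun v => z' v - w) ((1 / 10 : ℝ) * n) n) ≤ 1 - c ∧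
        μ.real (embTBCrossing (fun v => z' v - w) n ((1 / 10 : ℝ) * n)) ≤ 1 - c := by
    intro n hn w
    have h := hbd0 n hn (x + w)
    have hfun : (fun v => emb.z v - (x + w)) = fun v => z' v - w := by
      funext v; simp only [hz']; ring
    rw [hfun] at h
    exact h
  /- Step 5: the scales `m_k = M₀ 2^k`. -/
  set mk : ℕ → ℕ := fun k => M₀ * 2 ^ k with hmk
  have hmk1 : ∀ k, 1 ≤ mk k := fun k => by
    have : 1 ≤ 2 ^ k := Nat.one_le_two_pow
    simp only [hmk]; nlinarith
  have hmkM : ∀ k, M₀ ≤ mk k := fun k => by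
    have : 1 ≤ 2 ^ k := Nat.one_le_two_pow
    simp only [hmk]; nlinarith
  have hmkn : ∀ k, n₀ ≤ 20 * mk k := fun k => hM₀.trans (Nat.mul_le_mul_left _ (hmkM k))
  have hmk2 : ∀ j k, j < k → 2 * mk j ≤ mk k := fun j k hjk => by
    simp only [hmk]
    calc 2 * (M₀ * 2 ^ j) = M₀ * 2 ^ (j + 1) := by ring
      _ ≤ M₀ * 2 ^ k := Nat.mul_le_mul_left _ (Nat.pow_le_pow_right (by norm_num) hjk)
  have hmkK : ∀ k, k < K + 1 → (mk k : ℝ) ≤ M₀ * 2 ^ K := fun k hk => by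
    simp only [hmk]; push_cast
    exact mul_le_mul_of_nonneg_left (pow_le_pow_right₀ (by norm_num) (Nat.lt_succ_iff.1 hk))
      (by positivity)
  /- Step 6: the finite vertex sets carrying the strip events, pairwise disjoint. -/
  have hregfin : ∀ k, (region (mk k)).Finite := fun k =>
    (hfin (10 * (mk k : ℝ))).subset fun v hv => hv.2
  set T : ℕ → Finset V := fun k => (hregfin k).toFinset with hT
  have hTcoe : ∀ k, (↑(T k) : Set V) = region (mk k) := fun k =>
    Set.Finite.coe_toFinset _
  have hTdisj : ∀ j k, j ≠ k → Disjoint (T j) (T k) := by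
    intro j k hjk
    wlog hlt : j < k generalizing j k
    · exact (this k j (Ne.symm hjk) (lt_of_le_of_ne (not_lt.1 hlt) (Ne.symm hjk))).symm
    rw [Finset.disjoint_left]
    intro v hvj hvk
    have hvj' : v ∈ region (mk j) := by rw [← hTcoe]; exact Finset.mem_coe.2 hvj
    have hvk' : v ∈ region (mk k) := by rw [← hTcoe]; exact Finset.mem_coe.2 hvk
    have h2 : (2 : ℝ) * mk j ≤ mk k := by exact_mod_cast hmk2 j k hlt
    have h1 : (1 : ℝ) ≤ mk j := by exact_mod_cast hmk1 j
    linarith [hvj'.2, hvk'.1]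
  have hdet : ∀ k, DeterminedBy (U (mk k)) (↑(T k).sym2 : Set (Sym2 V)) := by
    intro k
    refine determinedBy_iUnion fun i => ?_
    obtain ⟨S, A, B, hSe, hS⟩ := hstripS (hmk1 k) i
    rw [hSe]
    exact determinedBy_openCrossing_of_subset (by rw [hTcoe]; exact hS) A B
  have hmeas : ∀ k i, MeasurableSet (strip (mk k) i) := by
    intro k i
    obtain ⟨S, A, B, hSe, hS⟩ := hstripS (hmk1 k) i
    rw [hSe]
    exact (determinedBy_openCrossing_of_subset (T := T k) (by rw [hTcoe]; exact hS) A B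
      ).measurableSet_of_finset
  have hmeasU : ∀ k, MeasurableSet (U (mk k)) := fun k => (hdet k).measurableSet_of_finset
  /- Step 7: each annulus is crossed with probability at most `1 - c⁴` (Harris). -/
  have hU : ∀ k, μ.real (U (mk k)) ≤ 1 - c ^ 4 := by
    intro k
    rw [hμ]
    refine prodBernoulli_real_iUnion_le emb.edgeWeight (strip (mk k)) (hupper (mk k)) (hmeas k)
      hc.le fun i => ?_
    have hb := hbd (20 * mk k) (hmkn k)
    fin_cases i
    · exact (hb _).1
    · exact (hb _).1
    · exact (hb _).2
    · exact (hb _).2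
  /- Step 8: independence over the annuli. -/
  have hind : μ.real (⋂ k ∈ Finset.range (K + 1), U (mk k)) =
      ∏ k ∈ Finset.range (K + 1), μ.real (U (mk k)) := by
    have hPD : (↑(Finset.range (K + 1)) : Set ℕ).PairwiseDisjoint fun k => (T k).sym2 :=
      fun j _ k _ hjk => disjoint_sym2_of_disjoint (hTdisj j k hjk)
    have h := prodBernoulli_real_inter_biInter_of_determinedBy emb.edgeWeight (Finset.range (K + 1))
      (fun k => (T k).sym2) hPD (fun k _ => hdet k) (fun k _ => hmeasU k)
      (A := Set.univ) (determinedBy_univ _) MeasurableSet.univ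
    rw [Set.univ_inter, probReal_univ, one_mul] at h
    rw [hμ]
    exact h
  /- Step 9: on the good set, the arm crosses every annulus. -/
  have hsub : Arm ∩ good ⊆ ⋂ k ∈ Finset.range (K + 1), U (mk k) := by
    intro ω hω
    obtain ⟨⟨u, v, huv, hu, hv⟩, hωE⟩ := hω
    simp only [Set.mem_iInter]
    intro k hk
    obtain ⟨w⟩ := huv
    have hk' : k < K + 1 := Finset.mem_range.1 hk
    have hM : (M₀ : ℝ) ≤ mk k := by exact_mod_cast hmkM k
    refine hmemU hωE (hmk1 k) w ?_ ?_
    · show (z' u).boxNorm ≤ 8 * (mk k) - 2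
      have : (z' u).boxNorm ≤ ρin := hu
      linarith
    · show 10 * (mk k : ℝ) - 2 ≤ (z' v).boxNorm
      have : ρout ≤ (z' v).boxNorm := hv
      linarith [hmkK k hk']
  /- Step 10: conclusion. -/
  calc μ.real (Arm ∩ good)
      ≤ μ.real (⋂ k ∈ Finset.range (K + 1), U (mk k)) := measureReal_mono hsub
    _ = ∏ k ∈ Finset.range (K + 1), μ.real (U (mk k)) := hind
    _ ≤ ∏ _k ∈ Finset.range (K + 1), (1 - c ^ 4) :=
        Finset.prod_le_prod (fun _ _ => measureReal_nonneg) fun k _ => hU k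
    _ = (1 - c ^ 4) ^ (K + 1) := by rw [Finset.prod_const, Finset.card_range]

/-- **The one-arm bound for critical bond percolation on `𝕋` in the route's isoradial drawing**
(`triIsoradialEmbedding`, `z x = √3 (triEmbed x − (1+ζ)/3)`; Grimmett–Manolescu 2014, proof of
Thm. 4 (b) "as in [GM1]", quantitative form with thin annuli): `real_openArm_le_pow` for
`𝕋 ∈ 𝒢` (`triGraph_preconnected`, `triIsoradialEmbedding_isIsoradial`,
`triIsoradialEmbedding_isRhombicTiling`, BAP(`π/6`)). -/
theorem triIso_openArm_le_pow : ∀ (c : ℝ), 0 < c → ∀ (n₀ : ℕ), (∀ n : ℕ, n₀ ≤ n → ∀ w : ℂ, Literature.Probability.LatticeModels.triIsoradialEmbedding.isoradialPercolation.real (Literature.Probability.LatticeModels.embRectCrossing (fun v => Literature.Probability.LatticeModels.triIsoradialEmbedding.z v - w) ((1 / 10 : ℝ) * n) n) ≤ 1 - c ∧ Literature.Probability.LatticeModels.triIsoradialEmbedding.isoradialPercolation.real (Literature.Probability.LatticeModels.embTBCrossing (fun v => Literature.Probability.LatticeModels.triIsoradialEmbedding.z v - w) n ((1 / 10 : ℝ)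 * n)) ≤ 1 - c) → ∀ (x : ℂ) (M₀ : ℕ), n₀ ≤ 20 * M₀ → 1 ≤ M₀ → ∀ (K : ℕ) (ρin ρout : ℝ), ρin ≤ 8 * M₀ - 2 → 10 * (M₀ : ℝ) * 2 ^ K - 2 ≤ ρout → Literature.Probability.LatticeModels.triIsoradialEmbedding.isoradialPercolation.real {ω | ∃ u v : Literature.Probability.LatticeModels.Site 2, (Literature.Probability.Percolation.openGraph ω).Reachable u v ∧ (Literature.Probability.LatticeModels.triIsoradialEmbedding.z u - x).boxNorm ≤ ρin ∧ ρout ≤ (Literature.Probability.LatticeModels.triIsoradialEmbedding.z v - x).boxNorm} ≤ (1 - c ^ 4) ^ (K + 1) :=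
  fun _c hc _n₀ hbd x _M₀ hM₀ hM₀1 K _ρin _ρout hin hout =>
    real_openArm_le_pow triIsoradialEmbedding triGraph_preconnected triIsoradialEmbedding_isIsoradial
      triIsoradialEmbedding_isRhombicTiling (by positivity : (0 : ℝ) < Real.pi / 6)
      triIsoradialEmbedding_hasBoundedAngles hc hbd x hM₀ hM₀1 K hin hout

end Summit.CriticalPhenomena.CardyFormulaZ2.Theorems

end
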